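import Literature.AlgebraicGeometry.HodgeTheory.GlZariskiClosureGroup
import HarnessLib

/-!
# Finite-index subgroups and the identity component of a Zariski closure, on `K`-points: powers,
# rootable elements, idempotence (Borel, *Linear Algebraic Groups*, I.1.2, I.2.1, I.2.4; CMSP
# Lemma–Definition 15.3.7)

Family `hodge`, layer `Literature/AlgebraicGeometry/HodgeTheory`. THEOREMS about the tree's `K`-points
Zariski closure `glZariskiClosure Γ` and identity component
`glIdentityComponent Γ = ⋂ {(Λ)^Zar : Λ ≤ Γ of finite index}` (`AlgebraicMonodromyMumfordTate`), companion
of `GlZariskiClosureGroup` (the closure is a group; commutators) and `ZariskiClosureBaseChange` (descent).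
Written by the prover seat `hodge-nonav-prover-A` (cell `hodge-nonav`) for the crux K1
`VeryGeneralDeckCommutatorsInHg` of `Summits/HodgeConjecture/HodgeConjecture/Theses/CyclicUnitaryPowers.lean`
(`stmt-HodgeConjecture-19544`; planner memo STUB-PLAN-B2-g19 §1 (E3) "finite-index transfer", lane-D
roadmap §2 (c) "`SL(E_j)(ℂ) ⊆ glIdentityComponent Γ_j`"): the passage from "`S ⊆ Γ^Zar`" to
"`S ⊆ (Γ^Zar)°`" for a set `S` of ROOTABLE automorphisms (unipotent one-parameter groups, tori).

The one idea (Borel I.2.1 (b) with I.1.2: a morphism of varieties carries the closure of `A` into the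
closure of the image of `A`): the power map `x ↦ x^M` is POLYNOMIAL in the matrix entries, so if it carries
`Γ` into a finite-index subgroup `Λ` it carries `Γ^Zar(K)` into `Λ^Zar(K)`
(`mem_zariskiClosureEndOfBasis_of_polynomialMap`, `pow_mem_glZariskiClosure_of_forall_pow_mem`); and for
`Λ ≤ Γ` of index `k`, `γ^{k!} ∈ Λ` for every `γ ∈ Γ` (Mathlib `Subgroup.pow_mem_of_index_ne_zero_of_dvd`).
Hence an automorphism admitting, for every `M ≥ 1`, an `M`-th root in `Γ^Zar(K)` lies in `Λ^Zar(K)` for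
every finite-index `Λ`, i.e. in `(Γ^Zar)°(K)` (`mem_glIdentityComponent_of_rootable`) — the points-level
form of "a divisible subgroup of an algebraic group lies in the identity component" / "connected
one-parameter subgroups lie in `G°`" (Borel I.2.2). No theory of algebraic groups is used.

## What is proved (any field `K`, `V` finite-dimensional over `K`)
* `mem_zariskiClosureEndOfBasis_of_polynomialMap` — pull-back of entry-closure membership along a map
  `φ : End V → End V` given by a matrix of polynomials in the entries (Borel AG §1 / I.1.2).
* `pow_mem_glZariskiClosure_of_forall_pow_mem` — `(∀ γ ∈ Γ, γ^M ∈ Λ) → g ∈ Γ^Zar → g^M ∈ Λ^Zar`.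
* `pow_factorial_index_mem_glZariskiClosure` — `Λ` of finite index `k` in `Γ`: `g ∈ Γ^Zar → g^{k!} ∈ Λ^Zar`.
* `glZariskiClosure_glZariskiClosureSubgroup` — idempotence `(Γ^Zar)^Zar = Γ^Zar` on `K`-points.
* `one_mem_glIdentityComponent`, `mul_mem_glIdentityComponent`, `inv_mem_glIdentityComponent`,
  `list_prod_mem_glIdentityComponent` — `(Γ^Zar)°(K)` is a subgroup (Borel I.1.2 (b); kept as membership
  lemmas, no new bundled object).
* **`mem_glIdentityComponent_of_rootable`** — an automorphism with `M`-th roots in `Γ^Zar(K)` for all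
  `M ≥ 1` lies in `(Γ^Zar)°(K)`; **`closure_subset_glIdentityComponent_of_rootable`** — the subgroup
  generated by a set of such automorphisms lies in `(Γ^Zar)°(K)` (Borel I.2.2: the group generated by a
  family of connected subvarieties through `e` is connected).

## References
* [Borel1991] A. Borel, *Linear Algebraic Groups*, 2nd ed., GTM 126 (1991): AG §1, I.1.2 (identity
  component: closed normal of finite index, contained in every closed finite-index subgroup), I.2.1
  (closures of subgroups; `f(Ā) ⊆ closure of f(A)`), I.2.2 (groups generated by connected subvarieties),
  I.2.4.
* [CarlsonMullerStachPeters2017] J. Carlson, S. Müller-Stach, C. Peters, *Period Mappings and Period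
  Domains*, 2nd ed. (2017), Lemma–Definition 15.3.7 (`Γ^Zar`, its connected component `Mon`; "a group of
  finite index of `Γ^Zar`").
-/

noncomputable section

open Literature.AlgebraicGeometry.Motives

namespace Literature.AlgebraicGeometry.HodgeTheory

/-! ### §1 Polynomial maps of `End(V)` preserve entry-closure membership -/

section PolynomialMap

universe u v

variable {K : Type u} [Field K] {V : Type v} [AddCommGroup V] [Module K V]
variable {ι : Type*} [Fintype ι] [DecidableEq ι]

/-- **Pull-back of closure membership along a polynomial map** (Borel AG §1, I.1.2, I.2.1: a morphism
carries the closure of `S` into the closure of its image). If `φ : End(V) → End(V)` is given in the basis `b`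
by a matrix `F` of polynomials in the entries — `[φ f]_b = F([f]_b)` — and `φ` maps `S` into `T`, then `φ`
maps the entry-closure of `S` into that of `T`: a polynomial `P` vanishing on `T` pulls back to the polynomial
`P ∘ F` vanishing on `S`. [cite: Borel1991, I.2.1] -/
theorem mem_zariskiClosureEndOfBasis_of_polynomialMap (b : Module.Basis ι K V) {S T : Set (Module.End K V)}
    (F : Matrix ι ι (MvPolynomial (ι × ι) K)) (φ : Module.End K V → Module.End K V)
    (hφ : ∀ f : Module.End K V, LinearMap.toMatrix b b (φ f) =
      (MvPolynomial.eval fun ij : ι × ι => LinearMap.toMatrix b b f ij.1 ij.2).mapMatrix F)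
    (hST : ∀ s ∈ S, φ s ∈ T) {f : Module.End K V} (hf : f ∈ zariskiClosureEndOfBasis b S) :
    φ f ∈ zariskiClosureEndOfBasis b T := by
  intro P hP
  -- `(P ∘ F)([g]) = P(F([g])) = P([φ g])`
  have hev : ∀ g : Module.End K V,
      MvPolynomial.eval (fun ij : ι × ι => LinearMap.toMatrix b b g ij.1 ij.2)
          (MvPolynomial.bind₁ (fun ij : ι × ι => F ij.1 ij.2) P) =
        MvPolynomial.eval (fun ij : ι × ι => LinearMap.toMatrix b b (φ g) ij.1 ij.2) P := by
    intro g
    rw [MvPolynomial.eval, MvPolynomial.eval₂Hom_bind₁, ← MvPolynomial.eval, ← MvPolynomial.eval]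
    refine congrArg (fun c => MvPolynomial.eval c P) (funext fun ij => ?_)
    rw [hφ g, RingHom.mapMatrix_apply, Matrix.map_apply]
  rw [← hev]
  exact hf _ fun s hs => by rw [hev]; exact hP _ (hST s hs)

/-- The power map `x ↦ x^M` in coordinates: `[f^M]_b` is the `M`-th power of the generic matrix evaluated
at `[f]_b`. [cite: Borel1991, I.2.1] -/
theorem toMatrix_pow_eq_mapMatrix_mvPolynomialX_pow (b : Module.Basis ι K V) (f : Module.End K V) (M : ℕ) :
    LinearMap.toMatrix b b (f ^ M) =
      (MvPolynomial.eval fun ij : ι × ι => LinearMap.toMatrix b b f ij.1 ij.2).mapMatrix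
        (Matrix.mvPolynomialX ι ι K ^ M) := by
  rw [← LinearMap.toMatrix_pow, map_pow (MvPolynomial.eval fun ij : ι × ι => LinearMap.toMatrix b b f ij.1 ij.2).mapMatrix,
    Matrix.mvPolynomialX_mapMatrix_eval]

end PolynomialMap

/-! ### §2 Powers: `Γ^Zar → Λ^Zar` along `x ↦ x^M` -/

section Powers

universe u v

variable {K : Type u} [Field K] {V : Type v} [AddCommGroup V] [Module K V] [Module.Finite K V]

omit [Module.Finite K V] in
/-- Powers of automorphisms, on underlying endomorphisms. [folklore] -/
private theorem coe_toLinearMap_pow' (e : V ≃ₗ[K] V) (k : ℕ) :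
    ((e ^ k : V ≃ₗ[K] V) : Module.End K V) = (e : Module.End K V) ^ k := by
  induction k with
  | zero => rw [pow_zero, pow_zero]; rfl
  | succ k ih => rw [pow_succ, pow_succ, LinearEquiv.coe_toLinearMap_mul, ih]

/-- **`x ↦ x^M` carries `Γ^Zar(K)` into `Λ^Zar(K)` whenever it carries `Γ` into `Λ`** (`Γ, Λ ≤ GL(V)` any
subgroups; the power map is polynomial in the entries, Borel I.2.1 (b)). [cite: Borel1991, I.2.1] -/
theorem pow_mem_glZariskiClosure_of_forall_pow_mem {Γ Λ : Subgroup (V ≃ₗ[K] V)} {M : ℕ}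
    (h : ∀ γ ∈ Γ, γ ^ M ∈ Λ) {g : V ≃ₗ[K] V} (hg : g ∈ glZariskiClosure Γ) :
    g ^ M ∈ glZariskiClosure Λ := by
  classical
  let b := Module.Free.chooseBasis K V
  rw [mem_glZariskiClosure_iff, ← zariskiClosureEnd_basis_indep b] at hg ⊢
  rw [coe_toLinearMap_pow']
  refine mem_zariskiClosureEndOfBasis_of_polynomialMap b (Matrix.mvPolynomialX _ _ K ^ M) (fun f => f ^ M)
    (fun f => toMatrix_pow_eq_mapMatrix_mvPolynomialX_pow b f M) ?_ hg
  rintro _ ⟨γ, hγ, rfl⟩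
  exact ⟨γ ^ M, h γ hγ, coe_toLinearMap_pow' γ M⟩

omit [Module.Finite K V] in
/-- **A finite-index subgroup contains a fixed power of every element**: if `Λ` has index `k ≠ 0` in
`Γ` (i.e. `Λ ⊓ Γ` has index `k` in `Γ`), then `γ^{k!} ∈ Λ` for every `γ ∈ Γ` (some power `γ^m`,
`0 < m ≤ k`, lies in `Λ` by pigeonhole on the cosets `γ^i Λ`, and `m ∣ k!`; Mathlib
`Subgroup.pow_mem_of_index_ne_zero_of_dvd`). Stated for subgroups of an arbitrary group. [folklore] -/
private theorem pow_factorial_index_mem {G : Type*} [Group G] {Γ Λ : Subgroup G}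
    (hk : (Λ.subgroupOf Γ).index ≠ 0) {γ : G} (hγ : γ ∈ Γ) :
    γ ^ (Λ.subgroupOf Γ).index.factorial ∈ Λ := by
  have h := Subgroup.pow_mem_of_index_ne_zero_of_dvd hk (⟨γ, hγ⟩ : Γ)
    (n := (Λ.subgroupOf Γ).index.factorial) fun m hm hmk => Nat.dvd_factorial hm hmk
  rw [Subgroup.mem_subgroupOf, SubmonoidClass.coe_pow] at h
  exact h

/-- **`g ∈ Γ^Zar(K) ⇒ g^{k!} ∈ Λ^Zar(K)`** for `Λ` of finite index `k` in `Γ` (CMSP 15.3.7: "a group of finite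
index of `Γ^Zar`"; Borel I.1.2: `(Λ)^Zar` has finite index in `Γ^Zar`). [cite: Borel1991, I.1.2 and I.2.1]
[cite: CarlsonMullerStachPeters2017, Lemma–Definition 15.3.7] -/
theorem pow_factorial_index_mem_glZariskiClosure {Γ Λ : Subgroup (V ≃ₗ[K] V)}
    (hfi : (Λ.subgroupOf Γ).FiniteIndex) {g : V ≃ₗ[K] V} (hg : g ∈ glZariskiClosure Γ) :
    g ^ (Λ.subgroupOf Γ).index.factorial ∈ glZariskiClosure Λ :=
  pow_mem_glZariskiClosure_of_forall_pow_mem (fun _ hγ => pow_factorial_index_mem hfi.index_ne_zero hγ) hg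

end Powers

/-! ### §3 Idempotence and the subgroup `(Γ^Zar)°(K)` -/

section Component

universe u v

variable {K : Type u} [Field K] {V : Type v} [AddCommGroup V] [Module K V] [Module.Finite K V]

/-- **Idempotence**: the closure of the closure is the closure, `(Γ^Zar(K))^Zar(K) = Γ^Zar(K)` — a polynomial
vanishing on `Γ` vanishes on `Γ^Zar(K)` by definition. [cite: Borel1991, I.2.1]
[cite: CarlsonMullerStachPeters2017, Lemma–Definition 15.3.7] -/
theorem glZariskiClosure_glZariskiClosureSubgroup (Γ : Subgroup (V ≃ₗ[K] V)) :
    glZariskiClosure (glZariskiClosureSubgroup Γ) = glZariskiClosure Γ := by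
  classical
  refine Set.Subset.antisymm ?_ ?_
  · intro g hg
    rw [mem_glZariskiClosure_iff] at hg ⊢
    intro P hP
    refine hg P ?_
    rintro _ ⟨x, hx, rfl⟩
    exact (mem_glZariskiClosure_iff Γ x).1 ((mem_glZariskiClosureSubgroup_iff Γ x).1 hx) P hP
  · exact (subset_glZariskiClosure (glZariskiClosureSubgroup Γ)).trans' fun g hg => hg

/-- `1 ∈ (Γ^Zar)°(K)`. [cite: Borel1991, I.1.2] -/
theorem one_mem_glIdentityComponent (Γ : Subgroup (V ≃ₗ[K] V)) : (1 : V ≃ₗ[K] V) ∈ glIdentityComponent Γ := by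
  rw [mem_glIdentityComponent_iff]
  intro Λ _ _
  exact one_mem_glZariskiClosure Λ

/-- `(Γ^Zar)°(K)` is closed under multiplication (an intersection of the subgroups `Λ^Zar(K)`).
[cite: Borel1991, I.1.2] -/
theorem mul_mem_glIdentityComponent {Γ : Subgroup (V ≃ₗ[K] V)} {g h : V ≃ₗ[K] V}
    (hg : g ∈ glIdentityComponent Γ) (hh : h ∈ glIdentityComponent Γ) : g * h ∈ glIdentityComponent Γ := by
  rw [mem_glIdentityComponent_iff] at hg hh ⊢
  intro Λ hΛ hfi
  exact mul_mem_glZariskiClosure (hg Λ hΛ hfi) (hh Λ hΛ hfi)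

/-- `(Γ^Zar)°(K)` is closed under inversion. [cite: Borel1991, I.1.2] -/
theorem inv_mem_glIdentityComponent {Γ : Subgroup (V ≃ₗ[K] V)} {g : V ≃ₗ[K] V}
    (hg : g ∈ glIdentityComponent Γ) : g⁻¹ ∈ glIdentityComponent Γ := by
  rw [mem_glIdentityComponent_iff] at hg ⊢
  intro Λ hΛ hfi
  exact inv_mem_glZariskiClosure (hg Λ hΛ hfi)

/-- `(Γ^Zar)°(K)` is closed under finite products (lists). [cite: Borel1991, I.1.2] -/
theorem list_prod_mem_glIdentityComponent {Γ : Subgroup (V ≃ₗ[K] V)} {l : List (V ≃ₗ[K] V)}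
    (hl : ∀ g ∈ l, g ∈ glIdentityComponent Γ) : l.prod ∈ glIdentityComponent Γ := by
  induction l with
  | nil => exact one_mem_glIdentityComponent Γ
  | cons g l ih =>
    rw [List.prod_cons]
    exact mul_mem_glIdentityComponent (hl g List.mem_cons_self) (ih fun x hx => hl x (List.mem_cons_of_mem g hx))

/-! ### §4 Rootable automorphisms lie in the identity component -/

/-- **Rootable points of `Γ^Zar` lie in `(Γ^Zar)°`**: if `a` admits, for every `M ≥ 1`, an `M`-th root `t`
in `Γ^Zar(K)`, then `a ∈ (Γ^Zar)°(K)` — for `Λ ≤ Γ` of finite index `k`, `a = t^{k!}` with `t ∈ Γ^Zar(K)`, and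
`t^{k!} ∈ Λ^Zar(K)` (`pow_factorial_index_mem_glZariskiClosure`). This is the `K`-points form of "a connected
(e.g. unipotent one-parameter, or torus) subgroup of `Γ^Zar` lies in `(Γ^Zar)°`" (Borel I.2.2), for the
divisible groups `{1 + t n}` and `K^×` (`K` algebraically closed of characteristic `0`). [cite: Borel1991, I.1.2 and I.2.2] -/
theorem mem_glIdentityComponent_of_rootable {Γ : Subgroup (V ≃ₗ[K] V)} {a : V ≃ₗ[K] V}
    (h : ∀ M : ℕ, 0 < M → ∃ t ∈ glZariskiClosure Γ, t ^ M = a) : a ∈ glIdentityComponent Γ := by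
  rw [mem_glIdentityComponent_iff]
  intro Λ _ hfi
  obtain ⟨t, ht, rfl⟩ := h _ (Nat.factorial_pos (Λ.subgroupOf Γ).index)
  exact pow_factorial_index_mem_glZariskiClosure hfi ht

/-- **The subgroup generated by rootable points of `Γ^Zar` lies in `(Γ^Zar)°`** (Borel I.2.2: the subgroup
generated by a family of connected subvarieties through `e` is connected). [cite: Borel1991, I.2.2] -/
theorem closure_subset_glIdentityComponent_of_rootable {Γ : Subgroup (V ≃ₗ[K] V)} {A : Set (V ≃ₗ[K] V)}
    (h : ∀ a ∈ A, ∀ M : ℕ, 0 < M → ∃ t ∈ glZariskiClosure Γ, t ^ M = a) :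
    (Subgroup.closure A : Set (V ≃ₗ[K] V)) ⊆ glIdentityComponent Γ := by
  intro g hg
  induction hg using Subgroup.closure_induction with
  | mem a ha => exact mem_glIdentityComponent_of_rootable (h a ha)
  | one => exact one_mem_glIdentityComponent Γ
  | mul x y _ _ hx hy => exact mul_mem_glIdentityComponent hx hy
  | inv x _ hx => exact inv_mem_glIdentityComponent hx

end Component

end Literature.AlgebraicGeometry.HodgeTheory

end
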